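import Summits.Ventures.PercRepro.RankLevelSetCoreSparse

/-!
# PercRepro — a fan of planes through a common line: at most `ν − 1` of them (night-1, gen 1; dossier §13.4, plane-section counts)

Let `ℓ` be a `3`-point line (a triangle) and `Q₁, …, Q_k` sets of rank `3` with `≥ 5` points, all containing `ℓ` and
pairwise meeting exactly in `ℓ` (distinct plane sections through `ℓ` do, under (C1)). Then their union has `≥ 3 + 2k`
points and rank `≤ 2 + k` (submodularity, one plane at a time), hence nullity `≥ k + 1`; so `k ≤ ν(S) − 1` for any
`S ⊇ ⋃ Qᵢ` with `|S| = r(S) + ν(S)`. This is the count «≤ ν − 1 planes with ≥ 5 points through a triangle» used for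
`q₅ ≤ s₄ + (ν−1)·s₃` in the regime-C budgets.

* `eRk_le_and_le_ncard_of_fan` — the induction: rank `≤ 2 + k`, size `≥ 3 + 2k`;
* **`card_fan_add_one_le`** — `k + 1 ≤ ν`;
* `inter_planeSections_eq_of_ne` — distinct plane sections `cl P ∩ S` through `ℓ` meet exactly in `ℓ` (under (C1)), which is
  the pairwise hypothesis of the fan bound for the plane sections of `S`;
* `fan_nullity_bound` — the general form `1 + (m − 4)·k ≤ ν` for sections with `≥ m` points (the 6- and 7-point counts);
* `ncard_add_ncard_le_of_inter_small` — two rank-3 sets sharing `≤ 2` points: `|Q| + |Q'| ≤ 6 + ν`.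
Axioms: standard.
-/

namespace PercRepro

namespace ThmN

open Set

variable {α : Type}

/-- **The fan induction**: for a finite family `s` of sets `Q ⊆ E`, each of rank `3` with `≥ 5` elements, each containing
the `3`-element set `ℓ` of rank `2`, pairwise meeting exactly in `ℓ`, the union `ℓ ∪ ⋃ Q` has rank `≤ 2 + |s|` and at
least `3 + 2|s|` elements. -/
theorem eRk_le_and_le_ncard_of_fan (M : Matroid α) [M.Finite] {ℓ : Set α} (hℓE : ℓ ⊆ M.E)
    (hℓ3 : ℓ.ncard = 3) (hℓr : M.eRk ℓ = 2) (m : ℕ) (s : Finset (Set α))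
    (hsE : ∀ Q ∈ s, Q ⊆ M.E) (hsr : ∀ Q ∈ s, M.eRk Q = 3) (hs5 : ∀ Q ∈ s, m ≤ Q.ncard)
    (hsℓ : ∀ Q ∈ s, ℓ ⊆ Q) (hpair : ∀ Q ∈ s, ∀ Q' ∈ s, Q ≠ Q' → Q ∩ Q' = ℓ) :
    M.eRk (ℓ ∪ ⋃ Q ∈ s, Q) ≤ ((2 + s.card : ℕ) : ℕ∞) ∧ 3 + (m - 3) * s.card ≤ (ℓ ∪ ⋃ Q ∈ s, Q).ncard := by
  classical
  induction s using Finset.induction_on with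
  | empty =>
    simp only [Finset.notMem_empty, Set.iUnion_of_empty, Set.iUnion_empty, Set.union_empty,
      Finset.card_empty, add_zero, mul_zero, hℓ3, hℓr]
    exact ⟨by norm_num, le_rfl⟩
  | insert Q₀ s hQ₀s ih =>
    have hsE' : ∀ Q ∈ s, Q ⊆ M.E := fun Q hQ => hsE Q (Finset.mem_insert_of_mem hQ)
    have hsr' : ∀ Q ∈ s, M.eRk Q = 3 := fun Q hQ => hsr Q (Finset.mem_insert_of_mem hQ)
    have hs5' : ∀ Q ∈ s, m ≤ Q.ncard := fun Q hQ => hs5 Q (Finset.mem_insert_of_mem hQ)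
    have hsℓ' : ∀ Q ∈ s, ℓ ⊆ Q := fun Q hQ => hsℓ Q (Finset.mem_insert_of_mem hQ)
    have hpair' : ∀ Q ∈ s, ∀ Q' ∈ s, Q ≠ Q' → Q ∩ Q' = ℓ :=
      fun Q hQ Q' hQ' h => hpair Q (Finset.mem_insert_of_mem hQ) Q' (Finset.mem_insert_of_mem hQ') h
    obtain ⟨ihr, ihc⟩ := ih hsE' hsr' hs5' hsℓ' hpair'
    have hQ₀mem : Q₀ ∈ insert Q₀ s := Finset.mem_insert_self Q₀ s
    have hQ₀E : Q₀ ⊆ M.E := hsE Q₀ hQ₀mem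
    have hQ₀r : M.eRk Q₀ = 3 := hsr Q₀ hQ₀mem
    have hQ₀5 : m ≤ Q₀.ncard := hs5 Q₀ hQ₀mem
    have hQ₀ℓ : ℓ ⊆ Q₀ := hsℓ Q₀ hQ₀mem
    set U : Set α := ℓ ∪ ⋃ Q ∈ s, Q with hU
    have hℓU : ℓ ⊆ U := Set.subset_union_left
    have hUE : U ⊆ M.E := by
      intro z hz
      rcases hz with hz | hz
      · exact hℓE hz
      · obtain ⟨Q, hQ, hzQ⟩ := Set.mem_iUnion₂.1 hz
        exact hsE' Q hQ hzQ
    have hUfin : U.Finite := M.ground_finite.subset hUE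
    have hQ₀fin : Q₀.Finite := M.ground_finite.subset hQ₀E
    have hℓfin : ℓ.Finite := M.ground_finite.subset hℓE
    have hnew : ℓ ∪ ⋃ Q ∈ insert Q₀ s, Q = Q₀ ∪ U := by
      rw [hU, Finset.set_biUnion_insert]
      ext z
      simp only [Set.mem_union]
      tauto
    -- `Q₀ ∩ U = ℓ`
    have hinter : Q₀ ∩ U = ℓ := by
      apply Set.Subset.antisymm
      · rintro z ⟨hzQ₀, hzU⟩
        rcases hzU with hz | hz
        · exact hz
        · obtain ⟨Q, hQ, hzQ⟩ := Set.mem_iUnion₂.1 hz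
          have hne : Q₀ ≠ Q := fun h => hQ₀s (h ▸ hQ)
          have := hpair Q₀ hQ₀mem Q (Finset.mem_insert_of_mem hQ) hne
          rw [← this]
          exact ⟨hzQ₀, hzQ⟩
      · intro z hz
        exact ⟨hQ₀ℓ hz, hℓU hz⟩
    rw [hnew, Finset.card_insert_of_notMem hQ₀s]
    constructor
    · -- submodularity: `r(Q₀ ∩ U) + r(Q₀ ∪ U) ≤ r(Q₀) + r(U)`
      have hsub := M.eRk_inter_add_eRk_union_le Q₀ U
      rw [hinter, hℓr, hQ₀r] at hsub
      have hneU : M.eRk (Q₀ ∪ U) ≠ ⊤ :=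
        ((M.eRk_le_encard _).trans_lt (hQ₀fin.union hUfin).encard_lt_top).ne
      have hneU' : M.eRk U ≠ ⊤ := ((M.eRk_le_encard _).trans_lt hUfin.encard_lt_top).ne
      obtain ⟨a, ha⟩ := ENat.ne_top_iff_exists.1 hneU
      obtain ⟨b, hb⟩ := ENat.ne_top_iff_exists.1 hneU'
      rw [← ha, ← hb] at hsub
      rw [← hb] at ihr
      rw [← ha]
      have h1 : 2 + a ≤ 3 + b := by exact_mod_cast hsub
      have h2 : b ≤ 2 + s.card := by exact_mod_cast ihr
      have h3 : a ≤ 2 + (s.card + 1) := by omega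
      exact_mod_cast h3
    · -- cardinality: `|Q₀ ∪ U| = |U| + |Q₀ ∖ ℓ| ≥ |U| + 2`
      have hdiff : Q₀ \ U = Q₀ \ ℓ := by rw [← hinter, Set.sdiff_self_inter]
      have hsplit : Q₀ ∪ U = U ∪ (Q₀ \ U) := by rw [Set.union_sdiff_self, Set.union_comm]
      have hQ₀ℓcard : m - 3 ≤ (Q₀ \ ℓ).ncard := by
        rw [Set.ncard_sdiff hQ₀ℓ hℓfin, hℓ3]
        omega
      rw [hsplit, Set.ncard_union_eq Set.disjoint_sdiff_right hUfin (hQ₀fin.sdiff), hdiff]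
      have : (m - 3) * (s.card + 1) = (m - 3) * s.card + (m - 3) := by ring
      omega

/-- **At most `ν − 1` planes with `≥ 5` points through a `3`-point line**: a fan of `k` such plane sections inside
`S ⊆ E` with `|S| = r(S) + ν` satisfies `k + 1 ≤ ν`. -/
theorem card_fan_add_one_le (M : Matroid α) [M.Finite] {S : Set α} (hS : S ⊆ M.E) {ν : ℕ}
    (hν : S.encard = M.eRk S + ν) {ℓ : Set α} (hℓS : ℓ ⊆ S) (hℓ3 : ℓ.ncard = 3) (hℓr : M.eRk ℓ = 2)
    (s : Finset (Set α)) (hsS : ∀ Q ∈ s, Q ⊆ S) (hsr : ∀ Q ∈ s, M.eRk Q = 3) (hs5 : ∀ Q ∈ s, 5 ≤ Q.ncard)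
    (hsℓ : ∀ Q ∈ s, ℓ ⊆ Q) (hpair : ∀ Q ∈ s, ∀ Q' ∈ s, Q ≠ Q' → Q ∩ Q' = ℓ) :
    s.card + 1 ≤ ν := by
  classical
  have hℓE : ℓ ⊆ M.E := hℓS.trans hS
  have hsE : ∀ Q ∈ s, Q ⊆ M.E := fun Q hQ => (hsS Q hQ).trans hS
  obtain ⟨hr, hc⟩ := eRk_le_and_le_ncard_of_fan M hℓE hℓ3 hℓr 5 s hsE hsr hs5 hsℓ hpair
  set U : Set α := ℓ ∪ ⋃ Q ∈ s, Q with hU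
  have hUS : U ⊆ S := by
    intro z hz
    rcases hz with hz | hz
    · exact hℓS hz
    · obtain ⟨Q, hQ, hzQ⟩ := Set.mem_iUnion₂.1 hz
      exact hsS Q hQ hzQ
  have hSfin : S.Finite := M.ground_finite.subset hS
  have hUfin : U.Finite := hSfin.subset hUS
  -- `r(S) ≤ r(U) + |S ∖ U|` and `|S| = |U| + |S ∖ U|`
  have hrS : M.eRk S ≤ M.eRk U + (S \ U).encard := by
    have := M.eRk_union_le_eRk_add_encard U (S \ U)
    rwa [Set.union_sdiff_cancel hUS] at this
  have hcard : S.ncard = U.ncard + (S \ U).ncard := by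
    conv_lhs => rw [← Set.union_sdiff_cancel hUS]
    exact Set.ncard_union_eq Set.disjoint_sdiff_right hUfin (hSfin.sdiff)
  have hneU : M.eRk U ≠ ⊤ := ((M.eRk_le_encard _).trans_lt hUfin.encard_lt_top).ne
  obtain ⟨a, ha⟩ := ENat.ne_top_iff_exists.1 hneU
  have hneS : M.eRk S ≠ ⊤ := ((M.eRk_le_encard _).trans_lt hSfin.encard_lt_top).ne
  obtain ⟨r, hr'⟩ := ENat.ne_top_iff_exists.1 hneS
  rw [← ha, ← hr', ← (hSfin.sdiff (t := U)).cast_ncard_eq] at hrS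
  rw [← ha] at hr
  rw [← hr', ← hSfin.cast_ncard_eq] at hν
  have e1 : r ≤ a + (S \ U).ncard := by exact_mod_cast hrS
  have e2 : a ≤ 2 + s.card := by exact_mod_cast hr
  have e3 : S.ncard = r + ν := by exact_mod_cast hν
  omega

/-- **Distinct plane sections through a `3`-point line meet exactly in that line** (under (C1)): for `P, P' ⊆ E` of
rank `3` whose closures contain the rank-`2` triple `ℓ ⊆ S` (no containment of `P, P'` in `E` is needed), if the sections `cl P ∩ S ≠ cl P' ∩ S` then
`(cl P ∩ S) ∩ (cl P' ∩ S) = ℓ` — the pairwise hypothesis of `card_fan_add_one_le` for the plane sections of `S`. -/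
theorem inter_planeSections_eq_of_ne (M : Matroid α) [M.Finite]
    (hC1 : ∀ L ⊆ M.E, M.eRk L = 2 → L.ncard ≤ 3) {S : Set α} (hS : S ⊆ M.E) {ℓ : Set α} (hℓS : ℓ ⊆ S)
    (hℓ3 : ℓ.ncard = 3) (hℓr : M.eRk ℓ = 2) {P P' : Set α}
    (hPr : M.eRk P = 3) (hP'r : M.eRk P' = 3) (hℓP : ℓ ⊆ M.closure P) (hℓP' : ℓ ⊆ M.closure P')
    (hne : M.closure P ∩ S ≠ M.closure P' ∩ S) :
    (M.closure P ∩ S) ∩ (M.closure P' ∩ S) = ℓ := by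
  set F : Set α := M.closure P ∩ M.closure P' with hF
  have hFE : F ⊆ M.E := Set.inter_subset_left.trans (M.closure_subset_ground P)
  have hFfin : F.Finite := M.ground_finite.subset hFE
  have hℓF : ℓ ⊆ F := Set.subset_inter hℓP hℓP'
  have hclPE : M.closure P ⊆ M.E := M.closure_subset_ground P
  have hclP'E : M.closure P' ⊆ M.E := M.closure_subset_ground P'
  -- `r(F) ≤ 2`: otherwise `cl F = cl P = cl P'`
  have hFr : M.eRk F ≤ 2 := by
    by_contra hlt
    push Not at hlt
    have h3 : (3 : ℕ∞) ≤ M.eRk F := by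
      have hne' : M.eRk F ≠ ⊤ := ((M.eRk_le_encard _).trans_lt hFfin.encard_lt_top).ne
      obtain ⟨k, hk⟩ := ENat.ne_top_iff_exists.1 hne'
      rw [← hk] at hlt ⊢
      have : 2 < k := by exact_mod_cast hlt
      exact_mod_cast this
    have hclP : M.closure P ⊆ M.closure F := by
      refine subset_closure_of_eRk_le M Set.inter_subset_left hclPE (M.ground_finite.subset hclPE) ?_
      rw [M.eRk_closure_eq, hPr]; exact h3
    have hclP' : M.closure P' ⊆ M.closure F := by
      refine subset_closure_of_eRk_le M Set.inter_subset_right hclP'E (M.ground_finite.subset hclP'E) ?_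
      rw [M.eRk_closure_eq, hP'r]; exact h3
    have hFclP : M.closure F ⊆ M.closure P := by
      calc M.closure F ⊆ M.closure (M.closure P) := M.closure_subset_closure Set.inter_subset_left
        _ = M.closure P := M.closure_closure P
    have hFclP' : M.closure F ⊆ M.closure P' := by
      calc M.closure F ⊆ M.closure (M.closure P') := M.closure_subset_closure Set.inter_subset_right
        _ = M.closure P' := M.closure_closure P'
    have heq : M.closure P = M.closure P' :=
      (Set.Subset.antisymm hclP hFclP).trans (Set.Subset.antisymm hFclP' hclP')
    exact hne (by rw [heq])
  -- hence `F ⊆ cl ℓ`, and `cl ℓ ∩ S = ℓ` by (C1)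
  have hFcl : F ⊆ M.closure ℓ :=
    subset_closure_of_eRk_le M hℓF hFE hFfin (by rw [hℓr]; exact hFr)
  have hG : M.closure ℓ ∩ S = ℓ := by
    have hGE : M.closure ℓ ∩ S ⊆ M.E := Set.inter_subset_right.trans hS
    have hℓG : ℓ ⊆ M.closure ℓ ∩ S := Set.subset_inter (M.subset_closure ℓ (hℓS.trans hS)) hℓS
    have hGr : M.eRk (M.closure ℓ ∩ S) = 2 := by
      apply le_antisymm
      · calc M.eRk (M.closure ℓ ∩ S) ≤ M.eRk (M.closure ℓ) := M.eRk_mono Set.inter_subset_left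
          _ = 2 := by rw [M.eRk_closure_eq, hℓr]
      · rw [← hℓr]; exact M.eRk_mono hℓG
    have hG3 := hC1 _ hGE hGr
    exact (Set.eq_of_subset_of_ncard_le hℓG (by rw [hℓ3]; exact hG3)
      (M.ground_finite.subset hGE)).symm
  apply Set.Subset.antisymm
  · intro z hz
    have hzF : z ∈ F := ⟨hz.1.1, hz.2.1⟩
    rw [← hG]
    exact ⟨hFcl hzF, hz.1.2⟩
  · intro z hz
    exact ⟨⟨hℓP hz, hℓS hz⟩, ⟨hℓP' hz, hℓS hz⟩⟩

/-- **General fan bound**: `k` plane sections with `≥ m` points through a `3`-point line, pairwise meeting in it, inside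
`S` with `|S| = r(S) + ν`, satisfy `1 + (m − 4)·k ≤ ν` (m = 5: `k ≤ ν − 1`; m = 6: `2k + 1 ≤ ν`; m = 7: `3k + 1 ≤ ν`). -/
theorem fan_nullity_bound (M : Matroid α) [M.Finite] {S : Set α} (hS : S ⊆ M.E) {ν : ℕ}
    (hν : S.encard = M.eRk S + ν) {ℓ : Set α} (hℓS : ℓ ⊆ S) (hℓ3 : ℓ.ncard = 3) (hℓr : M.eRk ℓ = 2)
    (m : ℕ) (hm : 4 ≤ m) (s : Finset (Set α)) (hsS : ∀ Q ∈ s, Q ⊆ S) (hsr : ∀ Q ∈ s, M.eRk Q = 3)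
    (hsm : ∀ Q ∈ s, m ≤ Q.ncard) (hsℓ : ∀ Q ∈ s, ℓ ⊆ Q)
    (hpair : ∀ Q ∈ s, ∀ Q' ∈ s, Q ≠ Q' → Q ∩ Q' = ℓ) :
    1 + (m - 4) * s.card ≤ ν := by
  classical
  have hℓE : ℓ ⊆ M.E := hℓS.trans hS
  have hsE : ∀ Q ∈ s, Q ⊆ M.E := fun Q hQ => (hsS Q hQ).trans hS
  obtain ⟨hr, hc⟩ := eRk_le_and_le_ncard_of_fan M hℓE hℓ3 hℓr m s hsE hsr hsm hsℓ hpair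
  set U : Set α := ℓ ∪ ⋃ Q ∈ s, Q with hU
  have hUS : U ⊆ S := by
    intro z hz
    rcases hz with hz | hz
    · exact hℓS hz
    · obtain ⟨Q, hQ, hzQ⟩ := Set.mem_iUnion₂.1 hz
      exact hsS Q hQ hzQ
  have hSfin : S.Finite := M.ground_finite.subset hS
  have hUfin : U.Finite := hSfin.subset hUS
  have hrS : M.eRk S ≤ M.eRk U + (S \ U).encard := by
    have := M.eRk_union_le_eRk_add_encard U (S \ U)
    rwa [Set.union_sdiff_cancel hUS] at this
  have hcard : S.ncard = U.ncard + (S \ U).ncard := by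
    conv_lhs => rw [← Set.union_sdiff_cancel hUS]
    exact Set.ncard_union_eq Set.disjoint_sdiff_right hUfin (hSfin.sdiff)
  have hneU : M.eRk U ≠ ⊤ := ((M.eRk_le_encard _).trans_lt hUfin.encard_lt_top).ne
  obtain ⟨a, ha⟩ := ENat.ne_top_iff_exists.1 hneU
  have hneS : M.eRk S ≠ ⊤ := ((M.eRk_le_encard _).trans_lt hSfin.encard_lt_top).ne
  obtain ⟨r, hr'⟩ := ENat.ne_top_iff_exists.1 hneS
  rw [← ha, ← hr', ← (hSfin.sdiff (t := U)).cast_ncard_eq] at hrS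
  rw [← ha] at hr
  rw [← hr', ← hSfin.cast_ncard_eq] at hν
  have e1 : r ≤ a + (S \ U).ncard := by exact_mod_cast hrS
  have e2 : a ≤ 2 + s.card := by exact_mod_cast hr
  have e3 : S.ncard = r + ν := by exact_mod_cast hν
  have e4 : (m - 3) * s.card = (m - 4) * s.card + s.card := by
    have : m - 3 = (m - 4) + 1 := by omega
    rw [this, Nat.add_mul, one_mul]
  omega

/-- **Two plane sections sharing at most two points**: if `Q, Q' ⊆ S` have rank `3` and `|Q ∩ Q'| ≤ 2` in a simple
matroid (pairs have rank `2`), then `ν(Q ∪ Q') ≥ ν(Q) + ν(Q')`, i.e. `|Q| + |Q'| ≤ 6 + ν(S)` — so two `6`-point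
sections need `ν ≥ 6` and a `6`- and a `7`-point section need `ν ≥ 7` when they share `≤ 2` points. -/
theorem ncard_add_ncard_le_of_inter_small (M : Matroid α) [M.Finite]
    (hs : ∀ e ∈ M.E, ∀ f ∈ M.E, e ≠ f → M.eRk {e, f} = 2) (hL : ∀ e ∈ M.E, M.IsNonloop e)
    {S : Set α} (hS : S ⊆ M.E) {ν : ℕ} (hν : S.encard = M.eRk S + ν) {Q Q' : Set α}
    (hQS : Q ⊆ S) (hQ'S : Q' ⊆ S) (hQr : M.eRk Q = 3) (hQ'r : M.eRk Q' = 3) (hint : (Q ∩ Q').ncard ≤ 2) :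
    Q.ncard + Q'.ncard ≤ 6 + ν := by
  classical
  have hSfin : S.Finite := M.ground_finite.subset hS
  have hQfin : Q.Finite := hSfin.subset hQS
  have hQ'fin : Q'.Finite := hSfin.subset hQ'S
  have hQE : Q ⊆ M.E := hQS.trans hS
  -- `r(Q ∩ Q') = |Q ∩ Q'|` (at most two points, simple)
  have hIr : M.eRk (Q ∩ Q') = (Q ∩ Q').ncard := by
    have hIE : Q ∩ Q' ⊆ M.E := Set.inter_subset_left.trans hQE
    have hIfin : (Q ∩ Q').Finite := hQfin.subset Set.inter_subset_left
    have hind : M.Indep (Q ∩ Q') := by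
      rcases Nat.lt_or_ge (Q ∩ Q').ncard 2 with h | h
      · rcases Nat.lt_or_ge (Q ∩ Q').ncard 1 with h0 | h1
        · have : Q ∩ Q' = ∅ := (Set.ncard_eq_zero hIfin).1 (by omega)
          rw [this]; exact M.empty_indep
        · obtain ⟨e, he⟩ := (Set.ncard_eq_one).1 (by omega : (Q ∩ Q').ncard = 1)
          rw [he, _root_.Matroid.indep_singleton]
          exact hL e (hIE (he ▸ Set.mem_singleton e))
      · obtain ⟨a, b, hab, hab'⟩ := (Set.ncard_eq_two).1 (by omega : (Q ∩ Q').ncard = 2)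
        have haE : a ∈ M.E := hIE (hab' ▸ Set.mem_insert a {b})
        have hbE : b ∈ M.E := hIE (hab' ▸ Set.mem_insert_of_mem a (Set.mem_singleton b))
        rw [hab']
        have h2 := hs a haE b hbE hab
        rw [_root_.Matroid.indep_iff_eRk_eq_encard_of_finite (by exact (Set.toFinite _)), h2,
          Set.encard_pair hab]
    rw [hind.eRk_eq_encard, hIfin.cast_ncard_eq]
  -- submodularity in `ℕ`
  have hsub := M.eRk_inter_add_eRk_union_le Q Q'
  rw [hIr, hQr, hQ'r] at hsub
  have hUfin : (Q ∪ Q').Finite := hQfin.union hQ'fin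
  have hneU : M.eRk (Q ∪ Q') ≠ ⊤ := ((M.eRk_le_encard _).trans_lt hUfin.encard_lt_top).ne
  obtain ⟨u, hu⟩ := ENat.ne_top_iff_exists.1 hneU
  rw [← hu] at hsub
  have e1 : (Q ∩ Q').ncard + u ≤ 3 + 3 := by exact_mod_cast hsub
  -- `|Q ∪ Q'| = |Q| + |Q'| − |Q ∩ Q'|`, and `|U| − r(U) ≤ ν`
  have hcardU : (Q ∪ Q').ncard + (Q ∩ Q').ncard = Q.ncard + Q'.ncard :=
    Set.ncard_union_add_ncard_inter Q Q' hQfin hQ'fin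
  have hUS : Q ∪ Q' ⊆ S := Set.union_subset hQS hQ'S
  have hrS : M.eRk S ≤ M.eRk (Q ∪ Q') + (S \ (Q ∪ Q')).encard := by
    have := M.eRk_union_le_eRk_add_encard (Q ∪ Q') (S \ (Q ∪ Q'))
    rwa [Set.union_sdiff_cancel hUS] at this
  have hcardS : S.ncard = (Q ∪ Q').ncard + (S \ (Q ∪ Q')).ncard := by
    conv_lhs => rw [← Set.union_sdiff_cancel hUS]
    exact Set.ncard_union_eq Set.disjoint_sdiff_right hUfin (hSfin.sdiff)
  have hneS : M.eRk S ≠ ⊤ := ((M.eRk_le_encard _).trans_lt hSfin.encard_lt_top).ne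
  obtain ⟨r, hr'⟩ := ENat.ne_top_iff_exists.1 hneS
  rw [← hu, ← hr', ← (hSfin.sdiff (t := Q ∪ Q')).cast_ncard_eq] at hrS
  rw [← hr', ← hSfin.cast_ncard_eq] at hν
  have e2 : r ≤ u + (S \ (Q ∪ Q')).ncard := by exact_mod_cast hrS
  have e3 : S.ncard = r + ν := by exact_mod_cast hν
  omega

end ThmN

end PercRepro
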